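import Summits.QuantumFields.BalabanUV.T4Continuum.Spine.NE3.FrameNormalisationOneLevel
import Summits.QuantumFields.BalabanUV.T4Continuum.Support.AveragingDeficitTransport
import HarnessLib

/-!
# T⁴ programme, node NE3 — census R50 open half (M1), THIRD BRICK: the covariant block oscillation `δ_v(y,Γ)` of a gauge is a product of its covariant BOND GRADIENTS along `Γ`,
# hence within `|Γ|·G` of `1` when every gradient is within `G` of `1` — `η ≤ d·L·G` on block tree contours (`FrameNormalisationOscillation`)

Cell `pub-balaban-gaps` (track G2, seat ne3, generation 11), row NE3; census `HOME/ne/NE3.md` §4 R50, §17 (M1).  `FrameNormalisationDefect` ∕ `FrameNormalisationDefectSize` show that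
the covariance defect of the one-step double-bar average (89) under an ARBITRARY gauge `v` is first order in `η := sup ‖δ_v(y,Γ_{y,x})^{∓1} − 1‖`, the covariant block
oscillation `δ_v(y,Γ) = v(y)⁻¹·R(V₀(Γ))v(y + disp Γ)`.  For the SMOOTH realisation of (M1) the gauge is controlled through its covariant BOND GRADIENTS
`g_v(x,ℓ) := v(x)⁻¹·R(V₀(ℓ_x))v(x + ℓ)` (one letter `ℓ = ±e_μ` from `x`; `(−1)`-size for the smooth corner interpolant); this module links the two (group algebra + the
triangle inequality for products of near-identity unitaries):

* §1 `covOsc_cons` — the one-letter recursion `δ_v(y, ℓ::Γ) = g_v(y,ℓ) · R(V₀(ℓ_y)) δ_v(y + ℓ, Γ)` (exact, every group-valued data).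
* §2 **`norm_covOsc_sub_one_le`** — for unitary `V₀`, `v` with `‖g_v(x,ℓ) − 1‖ ≤ G` for all `x, ℓ`: `‖δ_v(y,Γ) − 1‖ ≤ |Γ|·G` for every word `Γ` (induction on `Γ`;
  `B8Lemma1NonAbelian.norm_units_mul_sub_one_le`, unitary conjugation is an isometry `AveragingDeficitTransport.norm_Ad_of_unitary`).
* §3 **`norm_covOsc_treeWord_sub_one_le`** ∕ `norm_covOsc_treeWord_inv_sub_one_le` — on the block tree contours `Γ_{y,y+r}`, `r ∈ [0,L)^d` (`|Γ| = Σ rᵢ ≤ d·L`,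
  `B7Prop1Explicit.l1_boxVec_le`): `‖δ_v(y,Γ_{y,y+r})^{±1} − 1‖ ≤ d·L·G` — the `η` of `FrameNormalisationDefectSize.norm_twistedSum_sub_Fcov_le` is at most `d·L·G`.

HONEST FRAMING (page 1).  Bookkeeping on OUR objects (0 def, 0 sorry); the (M1) fixed point (smooth interpolant + contraction, jointly with (1.38)) is NOT done; nothing of
Bałaban's asserted; **NE3 NOT proved**; `PairLandauGaugeB8Avg` and the covariant root NOT proved; spine PROVED 0∕9; finite T⁴ rung (B)+1 — NOT continuum YM on ℝ⁴, NOT infinite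
volume, NOT mass gap, NOT `BetaPertH`, NOT Clay.  HONEST DEPENDENCY: continuum YM on T⁴ ⇐ BetaPertH ∧ nine spine estimates (0/9 proved); BetaPertH ⇐ (D1) ∧ (D4) ∧ CAP+tail;
G-an2-4 gates asym, D1 and NE2/3/4.  PLACEMENT: `Summits/QuantumFields/BalabanUV/T4Continuum/Spine/NE3/`; imports `FrameNormalisationOneLevel` and `Support/AveragingDeficitTransport`.

References: [Balaban1985Averaging] T. Bałaban, *Averaging operations for lattice gauge theories*, CMP 98 (1985) 17–51: (9) p. 18, (56)–(60) p. 27;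
[Balaban1985RegularSpaces] CMP 99 (1985), (1.36)–(1.37) p. 82.
-/

set_option autoImplicit false

open scoped BigOperators Matrix Matrix.Norms.L2Operator
open NormedSpace

namespace Summit.QuantumFields.BalabanUV.T4Continuum.NE3.FrameNormalisationOscillation

open Literature.MathematicalPhysics.QuantumFieldTheory.Balaban1983to89
open B7Prop1Explicit B7Prop2Explicit
open B7Eq92Concrete (Rc Rc_apply)
open T4AveragingDeficitWall (Ad)
open AveragingDeficitTransport (norm_Ad_of_unitary)

noncomputable section

variable {d : ℕ} {n : Type*} [Fintype n] [DecidableEq n]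

/-! ## §1 The one-letter recursion of the covariant oscillation -/

/-- **`δ_v(y, ℓ::Γ) = g_v(y,ℓ) · R(V₀(ℓ_y)) δ_v(y + ℓ, Γ)`** — the covariant oscillation along a word is the product of the first covariant bond gradient and the transported
oscillation of the tail (group algebra; (9) `hol_cons`). [folklore] -/
theorem covOsc_cons (V₀ : Site d → Fin d → (Matrix n n ℂ)ˣ) (v : Site d → (Matrix n n ℂ)ˣ) (y : Site d) (l : Letter d) (w : List (Letter d)) :
    (v y)⁻¹ * Rc (hol V₀ y (l :: w)) (v (y + disp (l :: w)))
      = ((v y)⁻¹ * Rc (stepHol V₀ y l) (v (y + l.vec))) *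
          Rc (stepHol V₀ y l) ((v (y + l.vec))⁻¹ * Rc (hol V₀ (y + l.vec) w) (v (y + l.vec + disp w))) := by
  rw [hol_cons, disp_cons, ← add_assoc]
  simp only [Rc_apply, map_mul, map_inv, mul_inv_rev]
  group

/-! ## §2 The oscillation along a word is within `|Γ|·G` of `1` -/

/-- **`‖δ_v(y,Γ) − 1‖ ≤ |Γ|·G`** for unitary `V₀`, `v` whose covariant bond gradients satisfy `‖v(x)⁻¹·R(V₀(ℓ_x))v(x+ℓ) − 1‖ ≤ G` for every site `x` and letter `ℓ`
(induction on `Γ`: a product of a unitary within `G` of `1` and a unitary conjugate of the tail oscillation). [folklore] -/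
theorem norm_covOsc_sub_one_le [Nonempty n] {V₀ : Site d → Fin d → (Matrix n n ℂ)ˣ} {v : Site d → (Matrix n n ℂ)ˣ} {G : ℝ}
    (hV₀ : ∀ (x : Site d) (κ : Fin d), V₀ x κ ∈ unitaryUnits (Matrix n n ℂ)) (hv : ∀ x : Site d, v x ∈ unitaryUnits (Matrix n n ℂ))
    (hg : ∀ (x : Site d) (l : Letter d), ‖((((v x)⁻¹ * Rc (stepHol V₀ x l) (v (x + l.vec))) : (Matrix n n ℂ)ˣ) : Matrix n n ℂ) - 1‖ ≤ G) :
    ∀ (w : List (Letter d)) (y : Site d),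
      ‖((((v y)⁻¹ * Rc (hol V₀ y w) (v (y + disp w))) : (Matrix n n ℂ)ˣ) : Matrix n n ℂ) - 1‖ ≤ (w.length : ℝ) * G := by
  letI : CStarAlgebra (Matrix n n ℂ) := {}
  -- unitary conjugation does not change the distance to `1`
  have hRc : ∀ {h : (Matrix n n ℂ)ˣ} (_ : h ∈ unitaryUnits (Matrix n n ℂ)) (X : (Matrix n n ℂ)ˣ),
      ‖((Rc h X : (Matrix n n ℂ)ˣ) : Matrix n n ℂ) - 1‖ = ‖(X : Matrix n n ℂ) - 1‖ := by
    intro h hh X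
    have hAd : ((Rc h X : (Matrix n n ℂ)ˣ) : Matrix n n ℂ) - 1 = Ad h ((X : Matrix n n ℂ) - 1) := by
      unfold Ad
      rw [Rc_apply, Units.val_mul, Units.val_mul, mul_sub, sub_mul, mul_one, Units.mul_inv]
    rw [hAd, norm_Ad_of_unitary hh]
  -- the gradients and the transported oscillations are unitary
  have hstep : ∀ (x : Site d) (l : Letter d), stepHol V₀ x l ∈ unitaryUnits (Matrix n n ℂ) := fun x l => stepHol_mem_of hV₀ x l
  have hgu : ∀ (x : Site d) (l : Letter d), (v x)⁻¹ * Rc (stepHol V₀ x l) (v (x + l.vec)) ∈ unitaryUnits (Matrix n n ℂ) := by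
    intro x l
    rw [Rc_apply]
    exact (unitaryUnits _).mul_mem ((unitaryUnits _).inv_mem (hv x))
      ((unitaryUnits _).mul_mem ((unitaryUnits _).mul_mem (hstep x l) (hv _)) ((unitaryUnits _).inv_mem (hstep x l)))
  intro w
  induction w with
  | nil =>
    intro y
    simp [disp, Rc_apply]
  | cons l w ih =>
    intro y
    rw [covOsc_cons, List.length_cons, Nat.cast_succ, add_mul, one_mul, add_comm ((w.length : ℝ) * G)]
    refine (B8Lemma1NonAbelian.norm_units_mul_sub_one_le (unitaryUnits_le_U1 (hgu y l))).trans (add_le_add (hg y l) ?_)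
    rw [hRc (hstep y l)]
    exact ih (y + l.vec)

/-! ## §3 On block tree contours: `η ≤ d·L·G` -/

/-- **`‖δ_v(y,Γ_{y,y+r}) − 1‖ ≤ d·L·G`** on the block tree contours (`|Γ_{y,y+r}| = Σᵢ rᵢ ≤ d·L`). [folklore] -/
theorem norm_covOsc_treeWord_sub_one_le [Nonempty n] (L : ℕ) {V₀ : Site d → Fin d → (Matrix n n ℂ)ˣ} {v : Site d → (Matrix n n ℂ)ˣ} {G : ℝ} (hG : 0 ≤ G)
    (hV₀ : ∀ (x : Site d) (κ : Fin d), V₀ x κ ∈ unitaryUnits (Matrix n n ℂ)) (hv : ∀ x : Site d, v x ∈ unitaryUnits (Matrix n n ℂ))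
    (hg : ∀ (x : Site d) (l : Letter d), ‖((((v x)⁻¹ * Rc (stepHol V₀ x l) (v (x + l.vec))) : (Matrix n n ℂ)ˣ) : Matrix n n ℂ) - 1‖ ≤ G)
    (y : Site d) (r : Fin d → Fin L) :
    ‖((((v y)⁻¹ * Rc (hol V₀ y (treeWord (boxVec L r))) (v (y + boxVec L r))) : (Matrix n n ℂ)ˣ) : Matrix n n ℂ) - 1‖ ≤ (d : ℝ) * L * G := by
  have h := norm_covOsc_sub_one_le hV₀ hv hg (treeWord (boxVec L r)) y
  rw [disp_treeWord, length_treeWord] at h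
  refine h.trans (mul_le_mul_of_nonneg_right ?_ hG)
  exact_mod_cast l1_boxVec_le (r := r)

/-- **`‖δ_v(y,Γ_{y,y+r})⁻¹ − 1‖ ≤ d·L·G`** — the inverse oscillation (the letter `η` of `FrameNormalisationDefectSize.norm_twistedSum_sub_Fcov_le`), since `δ_v` is unitary. [folklore] -/
theorem norm_covOsc_treeWord_inv_sub_one_le [Nonempty n] (L : ℕ) {V₀ : Site d → Fin d → (Matrix n n ℂ)ˣ} {v : Site d → (Matrix n n ℂ)ˣ} {G : ℝ} (hG : 0 ≤ G)
    (hV₀ : ∀ (x : Site d) (κ : Fin d), V₀ x κ ∈ unitaryUnits (Matrix n n ℂ)) (hv : ∀ x : Site d, v x ∈ unitaryUnits (Matrix n n ℂ))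
    (hg : ∀ (x : Site d) (l : Letter d), ‖((((v x)⁻¹ * Rc (stepHol V₀ x l) (v (x + l.vec))) : (Matrix n n ℂ)ˣ) : Matrix n n ℂ) - 1‖ ≤ G)
    (y : Site d) (r : Fin d → Fin L) :
    ‖(((((v y)⁻¹ * Rc (hol V₀ y (treeWord (boxVec L r))) (v (y + boxVec L r)))⁻¹ : (Matrix n n ℂ)ˣ)) : Matrix n n ℂ) - 1‖ ≤ (d : ℝ) * L * G := by
  letI : CStarAlgebra (Matrix n n ℂ) := {}
  have hu : (v y)⁻¹ * Rc (hol V₀ y (treeWord (boxVec L r))) (v (y + boxVec L r)) ∈ unitaryUnits (Matrix n n ℂ) := by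
    rw [Rc_apply]
    have hh := hol_mem_of hV₀ y (treeWord (boxVec L r))
    exact (unitaryUnits _).mul_mem ((unitaryUnits _).inv_mem (hv y))
      ((unitaryUnits _).mul_mem ((unitaryUnits _).mul_mem hh (hv _)) ((unitaryUnits _).inv_mem hh))
  exact (norm_inv_sub_one_le (unitaryUnits_le_U1 hu)).trans (norm_covOsc_treeWord_sub_one_le L hG hV₀ hv hg y r)

end

end Summit.QuantumFields.BalabanUV.T4Continuum.NE3.FrameNormalisationOscillation
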